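import Literature.MathematicalPhysics.QuantumManyBody.PeriodicFeynmanKacEnergyLower
import Literature.MathematicalPhysics.QuantumManyBody.BogoliubovSpectrumGP
import Mathlib.MeasureTheory.Function.L2Space
import Mathlib.Analysis.InnerProductSpace.Orthonormal
import HarnessLib

/-!
# The Ky Fan gap of the periodic `N`-body form from a two-level Rayleigh bound of the semigroup

Topic `Literature/MathematicalPhysics/QuantumManyBody`; theorems only (no definition, no named
fact). Companion of `PeriodicFeynmanKacEnergyLower.lean` (`ofReal_le_periodicEnergy_of_pairing_le`:
a UNIFORM Rayleigh bound `⟨f, e^{-tH}f⟩_cell ≤ e^{-λt}‖f‖²_cell` of the torus Feynman–Kac semigroup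
on periodic `C¹` real functions gives `λ ≤ 𝓔^per[Ψ]` for every periodic trial state) and of
`BogoliubovSpectrumGP.lean` (`kyFanTwo v N L`, the Ky Fan two-sum of the periodic `N`-body form over
`L²(cell)`-orthogonal pairs of the symmetric periodic `C¹` core). Here the Rayleigh bound is
TWO-LEVEL — the shape produced by a nondegenerate ground state `Ψ₀` with a spectral gap `γ`,
`⟨f, e^{-tH}f⟩_cell ≤ e^{-E₀t} a(f)² + e^{-(E₀+γ)t} (‖f‖²_cell - a(f)²)`, `a(f) = ⟨Ψ₀, f⟩_cell`, along
a sequence `t_k → 0⁺` — and the conclusion is the variational (min–max) statement for the two lowest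
levels [ReedSimonIV1978, Thm. XIII.1–2]:

* `ofReal_le_periodicEnergy_of_twoLevel` — `E₀ + γ (1 - a(re Ψ)² - a(im Ψ)²) ≤ 𝓔^per[Ψ]` for every
  periodic trial state `Ψ` (small-time form bound `form_upper_bound_periodic` of the tree on the real
  and imaginary parts, the two-level bound, and the slopes `(1 - e^{-ct})/t → c`); `a` is an
  arbitrary real functional here;
* `sum_sq_setIntegral_mul_le_one` — Bessel on the cell: for `Ψ₀` real with `∫_cell Ψ₀² ≤ 1` and an
  `L²(cell)`-orthogonal pair of trial states, `∑ⱼ (⟨Ψ₀, re Ψⱼ⟩² + ⟨Ψ₀, im Ψⱼ⟩²) ≤ 1`;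
* `ofReal_le_kyFanTwo_of_twoLevel` — **`2E₀ + γ ≤ kyFanTwo v N L`** when `a = ⟨Ψ₀, ·⟩_cell` with such
  a `Ψ₀` and `γ ≥ 0` (sum of the two one-state bounds and Bessel).

The semigroup side (the two-level bound from Perron–Frobenius, compactness and a Feynman–Kac ground
state) is `PeriodicKyFanGapFeynmanKac.lean`.

## References

* M. Reed, B. Simon, *Methods of Modern Mathematical Physics IV* (1978), Thm. XIII.1–2 (min–max),
  §XIII.12 Thm. XIII.44 (nondegenerate ground states). [ReedSimonIV1978]
* K. L. Chung, Z. Zhao, *From Brownian Motion to Schrödinger's Equation* (1995), Thm 3.27,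
  Prop 3.29 (81) (the variational top of the spectrum of a Feynman–Kac semigroup). [ChungZhao1995]
-/

noncomputable section

namespace Literature.MathematicalPhysics.QuantumManyBody.BoseGas

open MeasureTheory Filter Set
open scoped ENNReal NNReal Topology ComplexConjugate InnerProductSpace

variable {N : ℕ}

/-! ### The two-level Rayleigh bound gives `E₀ + γ(1 - a(re Ψ)² - a(im Ψ)²) ≤ 𝓔^per[Ψ]` -/

/-- **One-state lower bound from a two-level Rayleigh bound.** Let `v` be measurable with bounded
periodisation `v^per ≤ C` (`L > 0`), `a` any real functional on real functions, `E₀, γ` real, and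
`t_k → 0`, `t_k > 0`. If for every periodic `C¹` real `f` and every `k`
`⟨f, e^{-t_kH}f⟩_cell ≤ e^{-E₀t_k} a(f)² + e^{-(E₀+γ)t_k} (‖f‖²_cell - a(f)²)`, then for every periodic
trial state `Ψ`, `E₀ + γ (1 - a(re Ψ)² - a(im Ψ)²) ≤ 𝓔^per[Ψ]` (the form bound
`‖f‖²_cell - ⟨f, e^{-tH}f⟩_cell ≤ t 𝓔ℝ[f] + K t^{3/2}` on `re Ψ`, `im Ψ`, `𝓔^per[Ψ] = 𝓔ℝ[re Ψ] + 𝓔ℝ[im Ψ]`,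
`‖re Ψ‖² + ‖im Ψ‖² = 1`, and the slopes of `1 - e^{-ct}` at `0⁺`).
[cite: ChungZhao1995, Thm 3.27 and Prop 3.29 (81)] -/
theorem ofReal_le_periodicEnergy_of_twoLevel {L : ℝ} (hL : 0 < L) {v : ℝ → ℝ≥0∞}
    (hv : Measurable v) {C : ℝ≥0} (hC : ∀ x, periodizedPotential v L x ≤ C) {E₀ γ : ℝ}
    (a : (Config N → ℝ) → ℝ) {t : ℕ → ℝ} (ht : ∀ k, 0 < t k) (ht0 : Tendsto t atTop (𝓝 0))
    (htwo : ∀ f : Config N → ℝ, ContDiff ℝ 1 f →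
      (∀ (X : Config N) (i : Fin N) (k : Fin 3),
        f (X + Pi.single i (EuclideanSpace.single k L)) = f X) →
      ∀ k : ℕ, ∫ X in cellN N L, f X * pfkReal v L (t k) f X ≤
        Real.exp (-(E₀ * t k)) * a f ^ 2 +
          Real.exp (-((E₀ + γ) * t k)) * ((∫ X in cellN N L, f X ^ 2) - a f ^ 2))
    (Ψ : PeriodicTrialState N L) :
    ENNReal.ofReal (E₀ + γ * (1 - (a (fun Y => (Ψ.ψ Y).re) ^ 2 + a (fun Y => (Ψ.ψ Y).im) ^ 2))) ≤
      periodicEnergy v Ψ := by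
  by_cases hE : periodicEnergy v Ψ = ⊤
  · rw [hE]; exact le_top
  -- the two real components
  set f : Config N → ℝ := fun Y => (Ψ.ψ Y).re with hf
  set g : Config N → ℝ := fun Y => (Ψ.ψ Y).im with hg
  have hfC : ContDiff ℝ 1 f := Complex.reCLM.contDiff.comp Ψ.contDiff
  have hgC : ContDiff ℝ 1 g := Complex.imCLM.contDiff.comp Ψ.contDiff
  have hfper : ∀ (X : Config N) (i : Fin N) (k : Fin 3),
      f (X + Pi.single i (EuclideanSpace.single k L)) = f X := fun X i k => by
    simp only [hf, Ψ.periodic X i k]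
  have hgper : ∀ (X : Config N) (i : Fin N) (k : Fin 3),
      g (X + Pi.single i (EuclideanSpace.single k L)) = g X := fun X i k => by
    simp only [hg, Ψ.periodic X i k]
  have hsplit := periodicEnergy_eq_re_add_im hv Ψ
  have hmass := setLIntegral_cellN_re_sq_add_im_sq Ψ
  -- finiteness of the pieces
  set Kf := ∫⁻ X in cellN N L, realKinetic f X with hKf
  set Pf := ∫⁻ X in cellN N L, ENNReal.ofReal (f X ^ 2) * periodicInteraction v L X with hPf
  set Kg := ∫⁻ X in cellN N L, realKinetic g X with hKg
  set Pg := ∫⁻ X in cellN N L, ENNReal.ofReal (g X ^ 2) * periodicInteraction v L X with hPg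
  have hEeq : periodicEnergy v Ψ = (Kf + Pf) + (Kg + Pg) := hsplit
  have hfin : (Kf + Pf) + (Kg + Pg) ≠ ⊤ := hEeq ▸ hE
  have hKf' : Kf ≠ ⊤ := fun h => hfin (by simp [h])
  have hPf' : Pf ≠ ⊤ := fun h => hfin (by simp [h])
  have hKg' : Kg ≠ ⊤ := fun h => hfin (by simp [h])
  have hPg' : Pg ≠ ⊤ := fun h => hfin (by simp [h])
  have hmf : (∫⁻ X in cellN N L, ENNReal.ofReal (f X ^ 2)) ≠ ⊤ := fun h => by
    have := hmass; rw [h] at this; simp at this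
  have hmg : (∫⁻ X in cellN N L, ENNReal.ofReal (g X ^ 2)) ≠ ⊤ := fun h => by
    have := hmass; rw [h] at this; simp at this
  -- the real masses
  obtain ⟨Mf, -, hMf⟩ := exists_bound_of_continuous_periodic hL hfC.continuous hfper
  obtain ⟨Mg, -, hMg⟩ := exists_bound_of_continuous_periodic hL hgC.continuous hgper
  have hfsq : Integrable (fun X => f X ^ 2) (volume.restrict (cellN N L)) :=
    (memLp_two_cellN_of_bound L hfC.continuous.measurable hMf).integrable_sq
  have hgsq : Integrable (fun X => g X ^ 2) (volume.restrict (cellN N L)) :=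
    (memLp_two_cellN_of_bound L hgC.continuous.measurable hMg).integrable_sq
  have hmass' : (∫ X in cellN N L, f X ^ 2) + ∫ X in cellN N L, g X ^ 2 = 1 := by
    rw [← toReal_lintegral_sq hfsq, ← toReal_lintegral_sq hgsq, ← ENNReal.toReal_add hmf hmg, hmass,
      ENNReal.toReal_one]
  -- the form bounds
  obtain ⟨K1, hK1, hb1⟩ := form_upper_bound_periodic hv hL hC hfC hfper hKf' hPf'
  obtain ⟨K2, hK2, hb2⟩ := form_upper_bound_periodic hv hL hC hgC hgper hKg' hPg'
  set E : ℝ := (Kf.toReal + Pf.toReal) + (Kg.toReal + Pg.toReal) with hEdef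
  have hEreal : (periodicEnergy v Ψ).toReal = E := by
    rw [hEeq, ENNReal.toReal_add (ENNReal.add_ne_top.2 ⟨hKf', hPf'⟩) (ENNReal.add_ne_top.2 ⟨hKg', hPg'⟩),
      ENNReal.toReal_add hKf' hPf', ENNReal.toReal_add hKg' hPg']
  set A : ℝ := a f ^ 2 + a g ^ 2 with hA
  -- the key inequality for every `k`
  have hkey : ∀ k : ℕ, A * ((1 - Real.exp (-(E₀ * t k))) / t k) +
      (1 - A) * ((1 - Real.exp (-((E₀ + γ) * t k))) / t k) ≤ E + (K1 + K2) * Real.sqrt (t k) := by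
    intro k
    have htk := ht k
    set s : ℝ≥0 := ⟨t k, htk.le⟩ with hs
    have hst : (s : ℝ) = t k := rfl
    have hs0 : s ≠ 0 := fun h => htk.ne' (by rw [← hst, h]; rfl)
    have h1 := hb1 s hs0
    have h2 := hb2 s hs0
    have h3 := htwo f hfC hfper k
    have h4 := htwo g hgC hgper k
    rw [hst] at h1 h2
    have e3 : Real.exp (-((E₀ + γ) * t k)) * ((∫ X in cellN N L, f X ^ 2) + ∫ X in cellN N L, g X ^ 2) =
        Real.exp (-((E₀ + γ) * t k)) := by rw [hmass', mul_one]
    have hsum : A * (1 - Real.exp (-(E₀ * t k))) + (1 - A) * (1 - Real.exp (-((E₀ + γ) * t k))) ≤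
        t k * E + (K1 + K2) * (t k * Real.sqrt (t k)) := by
      rw [hA, hEdef]
      linarith [h1, h2, h3, h4, e3, hmass']
    have hdiv : A * ((1 - Real.exp (-(E₀ * t k))) / t k) +
        (1 - A) * ((1 - Real.exp (-((E₀ + γ) * t k))) / t k) =
        (A * (1 - Real.exp (-(E₀ * t k))) + (1 - A) * (1 - Real.exp (-((E₀ + γ) * t k)))) / t k := by
      ring
    rw [hdiv, div_le_iff₀ htk]
    calc _ ≤ t k * E + (K1 + K2) * (t k * Real.sqrt (t k)) := hsum
      _ = (E + (K1 + K2) * Real.sqrt (t k)) * t k := by ring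
  -- pass to the limit `k → ∞`
  have ht' : Tendsto t atTop (𝓝[>] 0) :=
    tendsto_nhdsWithin_iff.2 ⟨ht0, Eventually.of_forall fun k => ht k⟩
  have hlim1 : Tendsto (fun k => A * ((1 - Real.exp (-(E₀ * t k))) / t k) +
      (1 - A) * ((1 - Real.exp (-((E₀ + γ) * t k))) / t k)) atTop
      (𝓝 (A * E₀ + (1 - A) * (E₀ + γ))) :=
    (((tendsto_one_sub_exp_div_periodic E₀).comp ht').const_mul A).add
      (((tendsto_one_sub_exp_div_periodic (E₀ + γ)).comp ht').const_mul (1 - A))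
  have hlim2 : Tendsto (fun k => E + (K1 + K2) * Real.sqrt (t k)) atTop (𝓝 E) := by
    have hc : Continuous fun s : ℝ => E + (K1 + K2) * Real.sqrt s := by fun_prop
    have := (hc.tendsto 0).comp ht0
    simp only [Real.sqrt_zero, mul_zero, add_zero] at this
    exact this
  have hle : A * E₀ + (1 - A) * (E₀ + γ) ≤ E := le_of_tendsto_of_tendsto' hlim1 hlim2 hkey
  calc ENNReal.ofReal (E₀ + γ * (1 - A)) ≤ ENNReal.ofReal E := ENNReal.ofReal_le_ofReal (by linarith)
    _ = periodicEnergy v Ψ := by rw [← hEreal, ENNReal.ofReal_toReal hE]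

/-! ### Bessel on the cell for an orthogonal pair of trial states -/

/-- The `L²(cell)` seminorm of a periodic trial state is one. [folklore] -/
theorem PeriodicTrialState.eLpNorm_two_eq_one {L : ℝ} (Ψ : PeriodicTrialState N L) :
    eLpNorm Ψ.ψ 2 (volume.restrict (cellN N L)) = 1 := by
  rw [eLpNorm_eq_lintegral_rpow_enorm_toReal two_ne_zero ENNReal.ofNat_ne_top]
  have h : ∫⁻ X in cellN N L, ‖Ψ.ψ X‖ₑ ^ ((2 : ℝ≥0∞).toReal) = 1 := by
    rw [← Ψ.norm_eq]
    refine lintegral_congr fun X => ?_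
    rw [ENNReal.toReal_ofNat, ENNReal.rpow_two]
    rfl
  rw [h, ENNReal.one_rpow]

/-- A periodic trial state is in `L²(cell)`. [folklore] -/
theorem PeriodicTrialState.memLp_two {L : ℝ} (Ψ : PeriodicTrialState N L) :
    MemLp Ψ.ψ 2 (volume.restrict (cellN N L)) :=
  ⟨Ψ.contDiff.continuous.aestronglyMeasurable, by rw [Ψ.eLpNorm_two_eq_one]; exact ENNReal.one_lt_top⟩

/-- The `L²` inner product of two classes built from functions is the integral `∫ conj F · G`.
[folklore] -/
theorem inner_toLp_toLp_eq_integral {α : Type*} [MeasurableSpace α] {μ : Measure α} {F G : α → ℂ}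
    (hF : MemLp F 2 μ) (hG : MemLp G 2 μ) :
    ⟪hF.toLp F, hG.toLp G⟫_ℂ = ∫ x, conj (F x) * G x ∂μ := by
  rw [L2.inner_def]
  refine integral_congr_ae ?_
  filter_upwards [hF.coeFn_toLp, hG.coeFn_toLp] with x hFx hGx
  rw [hFx, hGx, RCLike.inner_apply']

/-- Bessel's inequality for an orthonormal pair (any inner product space). [folklore] -/
theorem norm_inner_sq_add_norm_inner_sq_le {H : Type*} [NormedAddCommGroup H] [InnerProductSpace ℂ H]
    {u₁ u₂ : H} (h₁ : ‖u₁‖ = 1) (h₂ : ‖u₂‖ = 1) (h₁₂ : ⟪u₁, u₂⟫_ℂ = 0) (x : H) :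
    ‖⟪u₁, x⟫_ℂ‖ ^ 2 + ‖⟪u₂, x⟫_ℂ‖ ^ 2 ≤ ‖x‖ ^ 2 := by
  have hon : Orthonormal ℂ ![u₁, u₂] := by
    rw [orthonormal_iff_ite]
    intro i j
    fin_cases i <;> fin_cases j
    · simp [inner_self_eq_norm_sq_to_K, h₁]
    · simp [h₁₂]
    · simp [← inner_conj_symm u₂ u₁, h₁₂]
    · simp [inner_self_eq_norm_sq_to_K, h₂]
  have := hon.sum_inner_products_le x (s := Finset.univ)
  simpa [Fin.sum_univ_two] using this

/-- The pairing `⟨Ψ, Ψ₀⟩_cell` of a trial state with a real `L²(cell)` function, squared in modulus: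
`|∫ conj Ψ · Ψ₀|² = (∫ Ψ₀ re Ψ)² + (∫ Ψ₀ im Ψ)²`. [folklore] -/
theorem norm_sq_setIntegral_conj_mul_ofReal {L : ℝ} {Ψ₀ : Config N → ℝ}
    (h0 : MemLp Ψ₀ 2 (volume.restrict (cellN N L))) (Ψ : PeriodicTrialState N L) :
    ‖∫ X in cellN N L, conj (Ψ.ψ X) * (Ψ₀ X : ℂ)‖ ^ 2 =
      (∫ X in cellN N L, Ψ₀ X * (Ψ.ψ X).re) ^ 2 + (∫ X in cellN N L, Ψ₀ X * (Ψ.ψ X).im) ^ 2 := by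
  set F : Config N → ℂ := fun X => conj (Ψ.ψ X) * (Ψ₀ X : ℂ) with hF
  have hconj : MemLp (fun X => conj (Ψ.ψ X)) 2 (volume.restrict (cellN N L)) :=
    Ψ.memLp_two.of_le (Complex.continuous_conj.comp Ψ.contDiff.continuous).aestronglyMeasurable
      (Eventually.of_forall fun X => by rw [Complex.norm_conj])
  have hint : Integrable F (volume.restrict (cellN N L)) := hconj.integrable_mul h0.ofReal
  have hre : (∫ X in cellN N L, F X).re = ∫ X in cellN N L, Ψ₀ X * (Ψ.ψ X).re := by
    have h := integral_re hint
    simp only [RCLike.re_to_complex] at h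
    rw [← h]
    refine integral_congr_ae (Eventually.of_forall fun X => ?_)
    simp only [hF, Complex.mul_re, Complex.conj_re, Complex.conj_im, Complex.ofReal_re,
      Complex.ofReal_im]
    ring
  have him : (∫ X in cellN N L, F X).im = -∫ X in cellN N L, Ψ₀ X * (Ψ.ψ X).im := by
    have h := integral_im hint
    simp only [RCLike.im_to_complex] at h
    rw [← h, ← integral_neg]
    refine integral_congr_ae (Eventually.of_forall fun X => ?_)
    simp only [hF, Complex.mul_im, Complex.conj_re, Complex.conj_im, Complex.ofReal_re,
      Complex.ofReal_im]
    ring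
  rw [Complex.sq_norm, Complex.normSq_apply, hre, him]
  ring

/-- **Bessel on the cell.** For a real `Ψ₀ ∈ L²(cell)` with `∫_cell Ψ₀² ≤ 1` and an
`L²(cell)`-orthogonal pair of periodic trial states `Ψ₁, Ψ₂`,
`∑ⱼ ((∫ Ψ₀ re Ψⱼ)² + (∫ Ψ₀ im Ψⱼ)²) ≤ 1` (Bessel's inequality for the orthonormal pair `Ψ₁, Ψ₂`
of `L²(cell; ℂ)` tested on `Ψ₀`). [folklore] -/
theorem sum_sq_setIntegral_mul_le_one {L : ℝ} {Ψ₀ : Config N → ℝ}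
    (h0 : MemLp Ψ₀ 2 (volume.restrict (cellN N L))) (h0n : ∫ X in cellN N L, Ψ₀ X ^ 2 ≤ 1)
    (Ψ₁ Ψ₂ : PeriodicTrialState N L) (horth : ∫ X in cellN N L, conj (Ψ₁.ψ X) * Ψ₂.ψ X = 0) :
    ((∫ X in cellN N L, Ψ₀ X * (Ψ₁.ψ X).re) ^ 2 + (∫ X in cellN N L, Ψ₀ X * (Ψ₁.ψ X).im) ^ 2) +
      ((∫ X in cellN N L, Ψ₀ X * (Ψ₂.ψ X).re) ^ 2 + (∫ X in cellN N L, Ψ₀ X * (Ψ₂.ψ X).im) ^ 2) ≤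
        1 := by
  have hc0 : MemLp (fun X => (Ψ₀ X : ℂ)) 2 (volume.restrict (cellN N L)) := h0.ofReal
  have h₁ : ‖Ψ₁.memLp_two.toLp Ψ₁.ψ‖ = 1 := by
    rw [Lp.norm_toLp, Ψ₁.eLpNorm_two_eq_one, ENNReal.toReal_one]
  have h₂ : ‖Ψ₂.memLp_two.toLp Ψ₂.ψ‖ = 1 := by
    rw [Lp.norm_toLp, Ψ₂.eLpNorm_two_eq_one, ENNReal.toReal_one]
  have h₁₂ : ⟪Ψ₁.memLp_two.toLp Ψ₁.ψ, Ψ₂.memLp_two.toLp Ψ₂.ψ⟫_ℂ = 0 := by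
    rw [inner_toLp_toLp_eq_integral, horth]
  -- `‖Ψ₀‖² = ∫_cell Ψ₀² ≤ 1`
  have hxx : ‖hc0.toLp (fun X => (Ψ₀ X : ℂ))‖ ^ 2 = ∫ X in cellN N L, Ψ₀ X ^ 2 := by
    have hI : ∫ X in cellN N L, conj (Ψ₀ X : ℂ) * (Ψ₀ X : ℂ) =
        ((∫ X in cellN N L, Ψ₀ X ^ 2 : ℝ) : ℂ) := by
      rw [← integral_complex_ofReal]
      refine integral_congr_ae (Eventually.of_forall fun X => ?_)
      simp only [Complex.conj_ofReal]
      push_cast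
      ring
    rw [← inner_self_eq_norm_sq (𝕜 := ℂ), inner_toLp_toLp_eq_integral, hI, RCLike.re_to_complex,
      Complex.ofReal_re]
  have hb := norm_inner_sq_add_norm_inner_sq_le h₁ h₂ h₁₂ (hc0.toLp (fun X => (Ψ₀ X : ℂ)))
  rw [inner_toLp_toLp_eq_integral, inner_toLp_toLp_eq_integral,
    norm_sq_setIntegral_conj_mul_ofReal h0 Ψ₁, norm_sq_setIntegral_conj_mul_ofReal h0 Ψ₂, hxx] at hb
  exact hb.trans h0n

/-! ### The Ky Fan gap -/

/-- **The Ky Fan gap from a two-level Rayleigh bound.** Let `v` be measurable with `v^per ≤ C`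
(`L > 0`), `Ψ₀` real, measurable, in `L²(cell)` with `∫_cell Ψ₀² ≤ 1`, `γ ≥ 0`, `t_k → 0⁺`. If for every
periodic `C¹` real `f` and every `k`,
`⟨f, e^{-t_kH}f⟩_cell ≤ e^{-E₀t_k} ⟨Ψ₀, f⟩² + e^{-(E₀+γ)t_k} (‖f‖²_cell - ⟨Ψ₀, f⟩²)`, then
`2E₀ + γ ≤ kyFanTwo v N L`: the sum of the energies of any `L²(cell)`-orthogonal pair of periodic trial
states is at least `2E₀ + γ (2 - ∑ⱼ |⟨Ψ₀, Ψⱼ⟩|²) ≥ 2E₀ + γ` (Bessel). This is the min–max statement "the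
two lowest levels are `E₀` and `≥ E₀ + γ`" of [ReedSimonIV1978, Thm. XIII.1–2] in the tree's Ky Fan
vocabulary. [cite: ReedSimonIV1978, Thm. XIII.1–2] -/
theorem ofReal_le_kyFanTwo_of_twoLevel {L : ℝ} (hL : 0 < L) {v : ℝ → ℝ≥0∞}
    (hv : Measurable v) {C : ℝ≥0} (hC : ∀ x, periodizedPotential v L x ≤ C) {E₀ γ : ℝ} (hγ : 0 ≤ γ)
    {Ψ₀ : Config N → ℝ} (h0 : MemLp Ψ₀ 2 (volume.restrict (cellN N L)))
    (h0n : ∫ X in cellN N L, Ψ₀ X ^ 2 ≤ 1)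
    {t : ℕ → ℝ} (ht : ∀ k, 0 < t k) (ht0 : Tendsto t atTop (𝓝 0))
    (htwo : ∀ f : Config N → ℝ, ContDiff ℝ 1 f →
      (∀ (X : Config N) (i : Fin N) (k : Fin 3),
        f (X + Pi.single i (EuclideanSpace.single k L)) = f X) →
      ∀ k : ℕ, ∫ X in cellN N L, f X * pfkReal v L (t k) f X ≤
        Real.exp (-(E₀ * t k)) * (∫ X in cellN N L, Ψ₀ X * f X) ^ 2 +
          Real.exp (-((E₀ + γ) * t k)) *
            ((∫ X in cellN N L, f X ^ 2) - (∫ X in cellN N L, Ψ₀ X * f X) ^ 2)) :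
    ENNReal.ofReal (2 * E₀ + γ) ≤ kyFanTwo v N L := by
  refine le_iInf fun Ψ₁ => le_iInf fun Ψ₂ => le_iInf fun horth => ?_
  have h1 := ofReal_le_periodicEnergy_of_twoLevel hL hv hC (fun f => ∫ X in cellN N L, Ψ₀ X * f X)
    ht ht0 htwo Ψ₁
  have h2 := ofReal_le_periodicEnergy_of_twoLevel hL hv hC (fun f => ∫ X in cellN N L, Ψ₀ X * f X)
    ht ht0 htwo Ψ₂
  have hB := sum_sq_setIntegral_mul_le_one h0 h0n Ψ₁ Ψ₂ horth
  dsimp only at h1 h2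
  set A₁ := (∫ X in cellN N L, Ψ₀ X * (Ψ₁.ψ X).re) ^ 2 + (∫ X in cellN N L, Ψ₀ X * (Ψ₁.ψ X).im) ^ 2
  set A₂ := (∫ X in cellN N L, Ψ₀ X * (Ψ₂.ψ X).re) ^ 2 + (∫ X in cellN N L, Ψ₀ X * (Ψ₂.ψ X).im) ^ 2
  have hsum : 2 * E₀ + γ ≤ (E₀ + γ * (1 - A₁)) + (E₀ + γ * (1 - A₂)) := by nlinarith [hB, hγ]
  calc ENNReal.ofReal (2 * E₀ + γ) ≤ ENNReal.ofReal ((E₀ + γ * (1 - A₁)) + (E₀ + γ * (1 - A₂))) :=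
        ENNReal.ofReal_le_ofReal hsum
    _ ≤ ENNReal.ofReal (E₀ + γ * (1 - A₁)) + ENNReal.ofReal (E₀ + γ * (1 - A₂)) := ENNReal.ofReal_add_le
    _ ≤ periodicEnergy v Ψ₁ + periodicEnergy v Ψ₂ := add_le_add h1 h2

end Literature.MathematicalPhysics.QuantumManyBody.BoseGas

end
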